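import Literature.Computability.Cryptography.HILLGreedyMachine
import Literature.Computability.Cryptography.LeftoverHashConditional
import Literature.Computability.Complexity.InteractiveProofsParallel
import Literature.Computability.Complexity.SamplingChernoff
import HarnessLib

/-!
# HILL Lemma 6.3.2: the laws of the greedy selection data (Håstad–Impagliazzo–Levin–Luby 1999, §6.3)

`HILLGreedySelection` analyses Phase 1 of HILL's adversary `M^{(A)}` for ABSTRACT data `Q : Greedy.Data N`
under the hypotheses `Q.Laws pmin`; `HILLGreedySamplers`/`HILLGreedyMachine` realise the concrete samplers,
estimator and machine.  This file instantiates the data with HILL's objects — `𝒯̃ = Tt f N`,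
`δ^{(τ)} = Pr[A(𝒟^{(τ)}) = 1] − Pr[A(ℰ^{(τ)}) = 1]`, the empirical estimate `Δ` — and PROVES the laws
[HILL 1999, Lemma 6.3.2, proof]:

* `|δ| ≤ 1`; **Fubini in the next free position** (`delta_fubini`: fixing position `|τ|` to a uniform `w`
  with `c = 0` is the fresh position — a window-substitution identity on the sampler's coins,
  `uniformAvg_window` with `Dsample_fix_eq`/`Esample_fix_eq`);
* **the estimate is `ρ`-accurate except with probability `2e^{−Ns ρ²/2}`** (`est_good`: Hoeffding over the
  `Ns` independent sample pairs, the tree's `card_upperDeviation_sum_le_exp` bridged to coin strings by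
  `uniformAvg_blocks`) [HILL: "sampling O(n/ρ²) times … Pr[|Δ − δ| > ρ] ≤ 2^{−n}"];
* **density**: `t*/2^{b} = #𝒯̃/2^N`, and both `𝒯̃` and its complement have density `≥ 2^{−b(N)}`
  (`card_T_one_le`: every `x ‖ 1^{b}` lies outside `𝒯₁` once `N ≥ 2`) [HILL: "1/n ≤ pₙ ≤ 1 − 1/n"];
* **claim (a)**: `E[δ^{(k)}] ≤ e^{−2·kc} + 2^{−N}` (`Ej_delta_le`): the Bernoulli bits of the template are
  `k` independent `p̃`-coins (Hoeffding lower tail), and on a template with `K·#{j : c_j = 1} ≥ m + 2N + 2`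
  hidden uniform bits the generalized Leftover Hash Lemma in test form
  (`LeftoverHash.leftoverHash_cond_minEntropy_test`, side information = public parts and `A`'s coins)
  bounds `δ^{(τ)}` by `2^{−N−1}` [HILL, proof of (a): "The entropy of the input to h' conditional on the
  rest of the bits of 𝒟^{(kₙ)} is at least Σ_j c_j … applying Lemma 4.5.1"].

No new named facts.
-/

namespace Literature.Computability.Cryptography

open Finset _root_.Computability Complexity HCProd Polynomial Real

namespace HILL

/-! ### Generic averaging identities -/

namespace GAvg

/-- Linearity. [folklore] -/
theorem uniformAvg_sub_fun (k : ℕ) (F G : List Bool → ℝ) : uniformAvg k (fun r => F r - G r) = uniformAvg k F - uniformAvg k G := by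
  unfold uniformAvg; rw [← sub_div, ← Finset.sum_sub_distrib]

/-- A prefix-only function: the trailing coins average out. [folklore] -/
theorem uniformAvg_take (a b : ℕ) (G : List Bool → ℝ) : uniformAvg (a + b) (fun r => G (r.take a)) = uniformAvg a G := by
  have h := uniformAvg_add a b (fun u _ => G u)
  simp only [uniformAvg_const] at h
  exact h

/-- A suffix-only function: the leading coins average out. [folklore] -/
theorem uniformAvg_drop (a b : ℕ) (G : List Bool → ℝ) : uniformAvg (a + b) (fun r => G (r.drop a)) = uniformAvg b G := by
  have h := uniformAvg_add a b (fun _ w => G w)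
  simp only [uniformAvg_const] at h
  exact h

/-- **Window substitution**: averaging `G` over a string whose window `[p, p + a)` is overwritten by an
independent uniform `x` is averaging `G`. [folklore] -/
theorem uniformAvg_window (p a c : ℕ) (G : List Bool → ℝ) :
    uniformAvg a (fun x => uniformAvg (p + a + c) fun r => G (r.take p ++ x ++ r.drop (p + a))) = uniformAvg (p + a + c) G := by
  -- right-hand side as a triple average
  have h1 := uniformAvg_add (p + a) c (fun u w => G (u ++ w))
  simp only [List.take_append_drop] at h1
  have h2 := uniformAvg_add p a (fun u₁ u₂ => uniformAvg c fun w => G (u₁ ++ u₂ ++ w))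
  simp only [List.take_append_drop] at h2
  have hR : uniformAvg (p + a + c) G = uniformAvg p fun u => uniformAvg a fun x => uniformAvg c fun w => G (u ++ x ++ w) :=
    h1.trans h2
  -- left-hand side: the window coins of `r` average out
  have hL : ∀ x : List Bool, uniformAvg (p + a + c) (fun r => G (r.take p ++ x ++ r.drop (p + a))) =
      uniformAvg p fun u => uniformAvg c fun w => G (u ++ x ++ w) := by
    intro x
    have h3 := uniformAvg_add (p + a) c (fun (u w : List Bool) => G (u.take p ++ x ++ w))
    simp only [List.take_take, min_eq_left (Nat.le_add_right p a)] at h3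
    have h4 := uniformAvg_add p a (fun (u₁ _ : List Bool) => uniformAvg c fun w => G (u₁ ++ x ++ w))
    simp only [uniformAvg_const] at h4
    exact h3.trans h4
  simp only [hL]
  rw [hR, uniformAvg_comm]

/-- **Coin strings as tuples of blocks**: the uniform average of a function of the `t` blocks of length `m`
is the normalised sum over `Fin t → {0,1}^m`. [folklore] -/
theorem uniformAvg_blocks (t m : ℕ) (Φ : (Fin t → List Bool) → ℝ) :
    uniformAvg (t * m) (fun r => Φ fun i => Greedy.blkL m i r) = (∑ g : Fin t → List.Vector Bool m, Φ fun i => (g i).toList) / 2 ^ (t * m) := by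
  unfold uniformAvg
  congr 1
  exact Fintype.sum_equiv (tupleVecEquiv t m).symm (fun v : List.Vector Bool (t * m) => Φ fun i => Greedy.blkL m i v.toList)
    (fun g => Φ fun i => (g i).toList) fun v => congrArg Φ (funext fun i => by
      have h := block_tupleVecEquiv ((tupleVecEquiv t m).symm v) i
      rw [Equiv.apply_symm_apply] at h
      exact h)

/-- **Hoeffding for block statistics** (two-sided, `[−1,1]`-valued): for `|X| ≤ 1` on blocks of length `m`,
among coin strings of `t ≥ 1` blocks the empirical mean of `X` deviates from `E X` by more than `ρ ≥ 0` with
probability at most `2 e^{−t ρ²/2}`. [cite: ImpagliazzoEtAl2010, Lemma 2.2 (Chernoff–Hoeffding)] -/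
theorem hoeffding_blocks {t : ℕ} (ht : 0 < t) (m : ℕ) (X : List Bool → ℝ) (hX : ∀ b, |X b| ≤ 1) {ρ : ℝ} (hρ : 0 ≤ ρ) :
    uniformAvg (t * m) (fun r => Greedy.ind (ρ < |(∑ i : Fin t, X (Greedy.blkL m i r)) / t - uniformAvg m X|)) ≤
      2 * exp (-(t * ρ ^ 2 / 2)) := by
  classical
  set F : List.Vector Bool m → ℝ := fun b => (X b.toList + 1) / 2 with hF
  have hF01 : ∀ b, F b ∈ Set.Icc (0 : ℝ) 1 := fun b => by
    have := abs_le.1 (hX b.toList); simp only [hF, Set.mem_Icc]; constructor <;> linarith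
  have hF01' : ∀ b, (1 - F b) ∈ Set.Icc (0 : ℝ) 1 := fun b => by
    have := hF01 b; simp only [Set.mem_Icc] at this ⊢; constructor <;> linarith
  have hcardα : (Fintype.card (List.Vector Bool m) : ℝ) = 2 ^ m := by rw [card_vector, Fintype.card_bool]; push_cast; ring
  have hμ : (∑ b : List.Vector Bool m, F b) / Fintype.card (List.Vector Bool m) = (uniformAvg m X + 1) / 2 := by
    rw [hcardα, uniformAvg]
    simp only [hF, Finset.sum_div, add_div]
    rw [Finset.sum_add_distrib, Finset.sum_const, Finset.card_univ, card_vector, Fintype.card_bool, nsmul_eq_mul]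
    push_cast
    have h2 : (0 : ℝ) < 2 ^ m := by positivity
    field_simp
  have hμ' : (∑ b : List.Vector Bool m, (1 - F b)) / Fintype.card (List.Vector Bool m) = 1 - (uniformAvg m X + 1) / 2 := by
    rw [Finset.sum_sub_distrib, sub_div, hμ, Finset.sum_const, Finset.card_univ, nsmul_eq_mul, mul_one, div_self]
    exact_mod_cast Fintype.card_pos.ne'
  have hη : 0 ≤ ρ / 2 := by linarith
  have h1 := card_upperDeviation_sum_le_exp F hF01 ht hη
  have h2 := card_upperDeviation_sum_le_exp (fun b => 1 - F b) hF01' ht hη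
  rw [hμ] at h1
  rw [hμ'] at h2
  have hΩ : (Fintype.card (Fin t → List.Vector Bool m) : ℝ) = 2 ^ (t * m) := by
    rw [Fintype.card_fun, Fintype.card_fin, card_vector, Fintype.card_bool]; push_cast; rw [← pow_mul, mul_comm]
  have hb := uniformAvg_blocks t m (fun g => Greedy.ind (ρ < |(∑ i : Fin t, X (g i)) / t - uniformAvg m X|))
  dsimp only at hb
  rw [hb]
  -- the deviation event is covered by the two one-sided events
  have hcover : ∀ g : Fin t → List.Vector Bool m,
      Greedy.ind (ρ < |(∑ i : Fin t, X (g i).toList) / t - uniformAvg m X|) ≤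
        (if (t : ℝ) * (ρ / 2) ≤ (∑ i, F (g i)) - t * ((uniformAvg m X + 1) / 2) then (1 : ℝ) else 0) +
          (if (t : ℝ) * (ρ / 2) ≤ (∑ i, (1 - F (g i))) - t * (1 - (uniformAvg m X + 1) / 2) then (1 : ℝ) else 0) := by
    intro g
    have htpos : (0 : ℝ) < t := by exact_mod_cast ht
    have hsumF : ∑ i, F (g i) = ((∑ i : Fin t, X (g i).toList) + t) / 2 := by
      simp only [hF]
      rw [← Finset.sum_div, Finset.sum_add_distrib, Finset.sum_const, Finset.card_univ, Fintype.card_fin, nsmul_eq_mul, mul_one]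
    have hsumF' : ∑ i, (1 - F (g i)) = t - ((∑ i : Fin t, X (g i).toList) + t) / 2 := by
      rw [Finset.sum_sub_distrib, hsumF, Finset.sum_const, Finset.card_univ, Fintype.card_fin, nsmul_eq_mul, mul_one]
    by_cases hev : ρ < |(∑ i : Fin t, X (g i).toList) / t - uniformAvg m X|
    · rw [Greedy.ind_of_true hev]
      rcases lt_abs.1 hev with hup | hlo
      · have : (t : ℝ) * (ρ / 2) ≤ (∑ i, F (g i)) - t * ((uniformAvg m X + 1) / 2) := by
          rw [hsumF]
          have := (lt_div_iff₀ htpos).1 (by linarith [hup] : uniformAvg m X + ρ < (∑ i : Fin t, X (g i).toList) / t)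
          nlinarith
        rw [if_pos this]; split_ifs <;> norm_num
      · have : (t : ℝ) * (ρ / 2) ≤ (∑ i, (1 - F (g i))) - t * (1 - (uniformAvg m X + 1) / 2) := by
          rw [hsumF']
          have := (div_lt_iff₀ htpos).1 (by linarith [hlo] : (∑ i : Fin t, X (g i).toList) / t < uniformAvg m X - ρ)
          nlinarith
        rw [if_pos this]; split_ifs <;> norm_num
    · rw [Greedy.ind_of_false hev]; split_ifs <;> norm_num
  have hpow : (0 : ℝ) < 2 ^ (t * m) := by positivity
  calc (∑ g : Fin t → List.Vector Bool m, Greedy.ind (ρ < |(∑ i : Fin t, X (g i).toList) / t - uniformAvg m X|)) / 2 ^ (t * m)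
      ≤ ((((univ.filter fun g : Fin t → List.Vector Bool m => (t : ℝ) * (ρ / 2) ≤ (∑ i, F (g i)) - t * ((uniformAvg m X + 1) / 2)).card : ℝ)) +
          ((univ.filter fun g : Fin t → List.Vector Bool m => (t : ℝ) * (ρ / 2) ≤ (∑ i, (1 - F (g i))) - t * (1 - (uniformAvg m X + 1) / 2)).card : ℝ)) /
            2 ^ (t * m) := by
        refine div_le_div_of_nonneg_right ?_ hpow.le
        rw [Finset.natCast_card_filter, Finset.natCast_card_filter, ← Finset.sum_add_distrib]
        exact Finset.sum_le_sum fun g _ => hcover g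
    _ ≤ (exp (-2 * t * (ρ / 2) ^ 2) * 2 ^ (t * m) + exp (-2 * t * (ρ / 2) ^ 2) * 2 ^ (t * m)) / 2 ^ (t * m) := by
        rw [← hΩ]; exact div_le_div_of_nonneg_right (add_le_add h1 h2) (by positivity)
    _ = 2 * exp (-(t * ρ ^ 2 / 2)) := by
        rw [show -2 * (t : ℝ) * (ρ / 2) ^ 2 = -(t * ρ ^ 2 / 2) by ring]
        field_simp
        ring

end GAvg

open GAvg

/-! ### `#𝒯₁ ≤ 2^N − 2^{n(N)}`: the complement of `𝒯̃` is not small -/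

/-- Every `x ‖ 1^{b}` lies outside `𝒯₁` once `N ≥ 2` (`⟦1^b⟧ = 2^b − 1 ≥ N > n + 1 ≥ D̃_f(f x) + 1`), so
`#𝒯₁ + 2^{n(N)} ≤ 2^N`. [cite: HastadImpagliazzoLevinLuby1999, §6.3 (last paragraph; 1/n ≤ pₙ ≤ 1 − 1/n)] -/
theorem card_T_one_le (f : List Bool → List Bool) {N : ℕ} (hN : 2 ≤ N) : (T f 1 N).card + 2 ^ nLen N ≤ 2 ^ N := by
  classical
  have hN1 : 1 ≤ N := by omega
  have hb2 : 2 ≤ bLen N := by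
    unfold bLen; have := Nat.log_pos (b := 2) (by norm_num) hN; omega
  have hnb := nLen_add_bLen hN1
  have hib := ibLen_eq hN1
  -- the vectors `x ‖ 1^b`
  set φ : List.Vector Bool (nLen N) → List.Vector Bool N := fun x => ⟨x.toList ++ ones (ibLen N), by
    rw [List.length_append, List.Vector.toList_length]; simp only [ones, List.length_replicate]; rw [hib]; omega⟩ with hφ
  have hinj : Function.Injective φ := by
    intro x y h
    have h' := congrArg (fun v : List.Vector Bool N => v.toList.take (nLen N)) h
    simp only [hφ, List.Vector.toList_mk] at h'
    rw [List.take_left' (List.Vector.toList_length x), List.take_left' (List.Vector.toList_length y)] at h'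
    exact List.Vector.toList_injective h'
  have hout : ∀ x, φ x ∉ T f 1 N := by
    intro x hx
    rw [mem_T] at hx
    have hlen : (ones (ibLen N)).length = ibLen N := by simp [ones]
    have h1 : iOf (φ x).toList = 2 ^ bLen N - 1 := by
      show iOf (x.toList ++ ones (ibLen N)) = _
      rw [iOf, iBits_append (List.Vector.toList_length x) hlen, Brick.bitsToNat_ones, hib]
    have h2 : Dtil f (xOf (φ x).toList) ≤ nLen N := by
      refine (Dtil_le f _).trans ?_
      rw [length_xOf, List.Vector.toList_length]
    have h3 : N < 2 ^ bLen N := lt_two_pow_bLen N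
    omega
  have hdisj : Disjoint (T f 1 N) (Finset.univ.image φ) := by
    rw [Finset.disjoint_left]
    rintro w hw hw'
    obtain ⟨x, -, rfl⟩ := Finset.mem_image.1 hw'
    exact hout x hw
  have hcard : (Finset.univ.image φ).card = 2 ^ nLen N := by
    rw [Finset.card_image_of_injective _ hinj, Finset.card_univ, card_vector, Fintype.card_bool]
  have h := Finset.card_le_univ (T f 1 N ∪ Finset.univ.image φ)
  rw [Finset.card_union_of_disjoint hdisj, hcard, card_vector, Fintype.card_bool] at h
  exact h

/-- Hence `t*(N) + 1 ≤ 2^{b(N)}` for `N ≥ 2`: the complement of `𝒯̃` has density at least `2^{−b}`. [folklore] -/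
theorem tStar_succ_le (f : List Bool → List Bool) {N : ℕ} (hN : 2 ≤ N) : tStar f N + 1 ≤ 2 ^ bLen N := by
  have hN1 : 1 ≤ N := by omega
  have h1 := card_T_one_le f hN
  have h2 : (Tt f N).card ≤ (T f 1 N).card := Finset.card_le_card (Tt_subset_T_one f N)
  rw [card_Tt] at h2
  have hnb := nLen_add_bLen hN1
  have hn : N - bLen N = nLen N := by omega
  rw [hn] at h2
  have hpow : 2 ^ N = 2 ^ bLen N * 2 ^ nLen N := by rw [← pow_add]; congr 1; omega
  rw [hpow] at h1
  have hpos : 0 < 2 ^ nLen N := Nat.two_pow_pos _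
  have : (tStar f N + 1) * 2 ^ nLen N ≤ 2 ^ bLen N * 2 ^ nLen N := by rw [Nat.succ_mul]; omega
  exact Nat.le_of_mul_le_mul_right this hpos

namespace GH

namespace Params

variable (P : Params) (f : List Bool → List Bool) (A : RandAlg (List Bool) Bool) (NsP τnP : Polynomial ℕ) (ρf : ℕ → ℝ)

/-! ### The concrete data of Lemma 6.3.2 -/

/-- The failure probability of one estimate: `2 e^{−Ns ρ²/2}`. [folklore] -/
noncomputable def ηf (N : ℕ) : ℝ := 2 * exp (-(NsP.eval N * ρf N ^ 2 / 2))

/-- **HILL's data at level `N`** (advice `t = t*(N)`): `𝒯̃`, `δ^{(τ)}`, the estimate `Δ`, the Bernoulli choice with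
`b(N)` coins and threshold `t*`, `τ(N)` candidates, `Ns(N)·cSamp` estimation coins, accuracy `ρ(N)`.
[cite: HastadImpagliazzoLevinLuby1999, Lemma 6.3.2 (proof, Phase 1)] -/
noncomputable def QD (N : ℕ) : Greedy.Data N :=
  { P.QM f A NsP τnP N (tStar f N) with
    Tt := HILL.Tt f N
    δ := P.delta f A N (tStar f N)
    ρ := ρf N
    η := ηf NsP ρf N }

variable {P f A NsP τnP ρf}

/-- The machine's view of the data is the data's own stage rule. [folklore] -/
theorem QD_stage (N : ℕ) : (P.QD f A NsP τnP ρf N).stage = (P.QM f A NsP τnP N (tStar f N)).stage := rfl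

/-- … and coin count. [folklore] -/
theorem QD_cS (N : ℕ) : (P.QD f A NsP τnP ρf N).cS = (P.QM f A NsP τnP N (tStar f N)).cS := rfl

/-- … and templates. [folklore] -/
theorem QD_templateOf (N : ℕ) : (P.QD f A NsP τnP ρf N).templateOf = (P.QM f A NsP τnP N (tStar f N)).templateOf := by
  funext j cc
  induction j generalizing cc with
  | zero => rfl
  | succ j ih => rw [Greedy.Data.templateOf, Greedy.Data.templateOf, ih, QD_stage, QD_cS]

/-! ### The estimate is accurate (Hoeffding) -/

/-- `|ind P − ind Q| ≤ 1`. [folklore] -/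
private theorem abs_ind_sub_ind_le (p q : Prop) : |Greedy.ind p - Greedy.ind q| ≤ 1 := by
  unfold Greedy.ind; split_ifs <;> norm_num

/-- **`Pr[|Δ − δ(τ·(w,c))| > ρ] ≤ 2e^{−Ns ρ²/2}`**: the `Ns` sample pairs are independent, each contributing a
`[−1,1]`-valued term of mean `δ`. [cite: HastadImpagliazzoLevinLuby1999, Lemma 6.3.2 (proof: "produce an estimate Δ … so that Pr[|Δ − δ| > ρ] ≤ 2^{−n}")] -/
theorem est_good_law {N : ℕ} (hNs : 0 < NsP.eval N) (hρ : 0 ≤ ρf N) (t : ℕ) (τ : List (List Bool × Bool)) (wc : List Bool × Bool) :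
    uniformAvg (P.cE A NsP N t) (fun ce => Greedy.ind (ρf N < |P.estim f A (NsP.eval N) N t τ wc ce - P.delta f A N t (τ ++ [wc])|)) ≤
      ηf NsP ρf N := by
  set X : List Bool → ℝ := fun blk => Greedy.ind (P.runD f A N t (τ ++ [wc]) false [] (blk.take (P.dTot A N t)) = true) -
    Greedy.ind (P.runE f A N t (τ ++ [wc]) false [] (blk.drop (P.dTot A N t)) = true) with hXdef
  have hX : ∀ b, |X b| ≤ 1 := fun b => abs_ind_sub_ind_le _ _
  have hmean : uniformAvg (P.cSamp A N t) X = P.delta f A N t (τ ++ [wc]) := by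
    rw [cSamp, hXdef, uniformAvg_sub_fun, delta, accD, accE]
    congr 1
    · exact uniformAvg_take (P.dTot A N t) (P.eTot A N t) (fun r => Greedy.ind (P.runD f A N t (τ ++ [wc]) false [] r = true))
    · exact uniformAvg_drop (P.dTot A N t) (P.eTot A N t) (fun r => Greedy.ind (P.runE f A N t (τ ++ [wc]) false [] r = true))
  have hest : ∀ ce, P.estim f A (NsP.eval N) N t τ wc ce = (∑ i : Fin (NsP.eval N), X (Greedy.blkL (P.cSamp A N t) i ce)) / NsP.eval N := by
    intro ce
    rw [estim, Fin.sum_univ_eq_sum_range (fun s => X (Greedy.blkL (P.cSamp A N t) s ce))]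
  have h := hoeffding_blocks hNs (P.cSamp A N t) X hX hρ
  rw [hmean] at h
  simp only [← hest] at h
  exact h

/-! ### Density -/

/-- `#𝒯̃ / 2^N = t* / 2^{b}` (`N ≥ 1`). [cite: HastadImpagliazzoLevinLuby1999, §6.3 (last paragraph: density exactly p̃ₙ)] -/
theorem density_law {N : ℕ} (hN : 1 ≤ N) : (tStar f N : ℝ) / 2 ^ bLen N = ((Tt f N).card : ℝ) / 2 ^ N := by
  rw [card_Tt]
  have hb := bLen_le hN
  have hpow : (2 : ℝ) ^ N = 2 ^ bLen N * 2 ^ (N - bLen N) := by rw [← pow_add]; congr 1; omega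
  rw [hpow]
  push_cast
  field_simp

/-! ### Fubini in the next free position (window substitution on the sampler's coins) -/

/-- Overwriting a window inside block `j` does not change the other blocks. [folklore] -/
theorem blkL_window_ne {L n j i : ℕ} (hn : n ≤ L) {r w : List Bool} (hw : w.length = n) (hr : (j + 1) * L ≤ r.length) (hij : i ≠ j) :
    Greedy.blkL L i (r.take (j * L) ++ w ++ r.drop (j * L + n)) = Greedy.blkL L i r := by
  unfold Greedy.blkL
  rw [Nat.succ_mul] at hr
  have hT : (r.take (j * L)).length = j * L := by rw [List.length_take]; omega
  have hTw : (r.take (j * L) ++ w).length = j * L + n := by rw [List.length_append, hT, hw]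
  rcases Nat.lt_or_gt_of_ne hij with h | h
  · -- `i < j`: block `i` lies in the untouched prefix
    have hiL : i * L + L ≤ j * L := by have := Nat.mul_le_mul_right L h; rw [Nat.succ_mul] at this; omega
    have hdT : (List.drop (i * L) (r.take (j * L))).length = j * L - i * L := by rw [List.length_drop, hT]
    rw [List.drop_append_of_le_length (by rw [hTw]; omega), List.drop_append_of_le_length (by rw [hT]; omega),
      List.take_append_of_le_length (by rw [List.length_append, hdT, hw]; omega),
      List.take_append_of_le_length (by rw [hdT]; omega), List.drop_take, List.take_take, min_eq_left (by omega)]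
  · -- `j < i`: block `i` lies in the untouched suffix
    have hiL : j * L + L ≤ i * L := by have := Nat.mul_le_mul_right L h; rw [Nat.succ_mul] at this; omega
    rw [List.drop_append, List.drop_eq_nil_of_le (by rw [hTw]; omega), List.nil_append, hTw, List.drop_drop]
    congr 2
    omega

/-- Overwriting the first `n` bits of block `j`. [folklore] -/
theorem blkL_window_self {L n j : ℕ} (hn : n ≤ L) {r w : List Bool} (hw : w.length = n) (hr : (j + 1) * L ≤ r.length) :
    Greedy.blkL L j (r.take (j * L) ++ w ++ r.drop (j * L + n)) = w ++ (Greedy.blkL L j r).drop n := by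
  unfold Greedy.blkL
  rw [Nat.succ_mul] at hr
  have hT : (r.take (j * L)).length = j * L := by rw [List.length_take]; omega
  have hTw : (r.take (j * L) ++ w).length = j * L + n := by rw [List.length_append, hT, hw]
  rw [List.drop_append_of_le_length (by rw [hTw]; omega), List.drop_append_of_le_length (by rw [hT]),
    List.drop_eq_nil_of_le (by rw [hT]), List.nil_append, List.take_append, List.take_of_length_le (by rw [hw]; exact hn), hw,
    List.drop_take, List.drop_drop]

/-- Taking a long prefix of a window-substituted string. [folklore] -/
theorem take_window {p n m : ℕ} {r w : List Bool} (hw : w.length = n) (hm : p + n ≤ m) (hr : m ≤ r.length) :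
    (r.take p ++ w ++ r.drop (p + n)).take m = (r.take m).take p ++ w ++ (r.take m).drop (p + n) ∧
      (r.take p ++ w ++ r.drop (p + n)).drop m = r.drop m := by
  have hT : (r.take p).length = p := by rw [List.length_take]; omega
  have hTw : (r.take p ++ w).length = p + n := by rw [List.length_append, hT, hw]
  constructor
  · rw [List.take_append, List.take_of_length_le (by rw [hTw]; exact hm), hTw, List.take_take, min_eq_left (by omega : p ≤ m),
      List.drop_take]
  · rw [List.drop_append, List.drop_eq_nil_of_le (by rw [hTw]; exact hm), List.nil_append, hTw, List.drop_drop]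
    congr 1
    omega

/-- The slices of position coins whose candidate slot is overwritten. [folklore] -/
theorem pc_slices_window {N : ℕ} {w : List Bool} (hw : w.length = N) (pc : List Bool) :
    pcW N (w ++ pc.drop N) = w ∧ pcR N (w ++ pc.drop N) = pcR N pc ∧ pcS N (w ++ pc.drop N) = pcS N pc ∧
      pcU N (w ++ pc.drop N) = pcU N pc := by
  refine ⟨List.take_left' hw, ?_, ?_, ?_⟩
  · unfold pcR; rw [List.drop_left' hw]
  · unfold pcS; rw [← List.drop_drop, List.drop_left' hw, List.drop_drop]
  · unfold pcU; rw [Nat.add_assoc, ← List.drop_drop, List.drop_left' hw, List.drop_drop]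

/-- Fixing position `|τ|` does not change the other positions. [folklore] -/
theorem posPub_fix_ne {N : ℕ} (τ : List (List Bool × Bool)) (wc : List Bool × Bool) {i : ℕ} (hi : i ≠ τ.length) (pc : List Bool) :
    posPub f N (τ ++ [wc]) false [] i pc = posPub f N τ false [] i pc := by
  have hlen : (τ ++ [wc]).length = τ.length + 1 := by rw [List.length_append, List.length_singleton]
  unfold posPub
  rcases Nat.lt_or_gt_of_ne hi with h | h
  · rw [if_pos (show i < (τ ++ [wc]).length by rw [hlen]; omega), if_pos h, List.getD_append _ _ _ _ h]
  · rw [if_neg (show ¬ i < (τ ++ [wc]).length by rw [hlen]; omega), if_neg (show ¬ i < τ.length by omega),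
      if_neg (show ¬ (false = true ∧ i = (τ ++ [wc]).length) by simp), if_neg (show ¬ (false = true ∧ i = τ.length) by simp)]

/-- Fixing position `|τ|` does not change the other blocks. [folklore] -/
theorem posBlk_fix_ne {N : ℕ} (τ : List (List Bool × Bool)) (wc : List Bool × Bool) {i : ℕ} (hi : i ≠ τ.length) (pc : List Bool) :
    posBlk N (τ ++ [wc]) false [] i pc = posBlk N τ false [] i pc := by
  have hlen : (τ ++ [wc]).length = τ.length + 1 := by rw [List.length_append, List.length_singleton]
  unfold posBlk
  rcases Nat.lt_or_gt_of_ne hi with h | h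
  · rw [if_pos (show i < (τ ++ [wc]).length by rw [hlen]; omega), if_pos h, List.getD_append _ _ _ _ h]
  · rw [if_neg (show ¬ i < (τ ++ [wc]).length by rw [hlen]; omega), if_neg (show ¬ i < τ.length by omega),
      if_neg (show ¬ (false = true ∧ i = (τ ++ [wc]).length) by simp), if_neg (show ¬ (false = true ∧ i = τ.length) by simp)]

/-- **Fixing position `|τ|` to `(w, 0)` is the fresh position with candidate `w`.** [cite: HastadImpagliazzoLevinLuby1999, Lemma 6.3.2 (proof: 𝒟^{(j-1)}_{c}(w_m), "the same as 𝒟^{(j-1)} except that ⟨X'_j, I'_j⟩ is fixed to w_m")] -/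
theorem posPub_fix_self {N : ℕ} (τ : List (List Bool × Bool)) {w : List Bool} (hw : w.length = N) (pc : List Bool) :
    posPub f N (τ ++ [(w, false)]) false [] τ.length pc = posPub f N τ false [] τ.length (w ++ pc.drop N) := by
  obtain ⟨h1, h2, h3, -⟩ := pc_slices_window hw pc
  have hlen : (τ ++ [(w, false)]).length = τ.length + 1 := by rw [List.length_append, List.length_singleton]
  unfold posPub
  rw [if_pos (show τ.length < (τ ++ [(w, false)]).length by rw [hlen]; omega), if_neg (lt_irrefl _),
    if_neg (show ¬ (false = true ∧ τ.length = τ.length) by simp),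
    List.getD_append_right _ _ _ _ le_rfl, Nat.sub_self, List.getD_cons_zero, h1, h2, h3]

/-- The block version. [folklore] -/
theorem posBlk_fix_self {N : ℕ} (τ : List (List Bool × Bool)) {w : List Bool} (hw : w.length = N) (pc : List Bool) :
    posBlk N (τ ++ [(w, false)]) false [] τ.length pc = posBlk N τ false [] τ.length (w ++ pc.drop N) := by
  obtain ⟨h1, -, h3, -⟩ := pc_slices_window hw pc
  have hlen : (τ ++ [(w, false)]).length = τ.length + 1 := by rw [List.length_append, List.length_singleton]
  unfold posBlk
  rw [if_pos (show τ.length < (τ ++ [(w, false)]).length by rw [hlen]; omega), if_neg (lt_irrefl _),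
    if_neg (show ¬ (false = true ∧ τ.length = τ.length) by simp),
    List.getD_append_right _ _ _ _ le_rfl, Nat.sub_self, List.getD_cons_zero, h1, h3]
  rfl

/-- `N ≤ cP N`. [folklore] -/
theorem le_cP (N : ℕ) : N ≤ cP N := by unfold cP; omega

/-- **The samples with position `|τ| < k` fixed to `(w, 0)` are the samples of `τ` with the candidate slot of
block `|τ|` overwritten by `w`.** [folklore] -/
theorem samples_fix_eq {N t : ℕ} {τ : List (List Bool × Bool)} (hτ : τ.length < P.kk N) {w : List Bool} (hw : w.length = N)
    {pcs : List Bool} (hpcs : P.kk N * cP N ≤ pcs.length) (U Z : List Bool) :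
    P.Dsample f N t (τ ++ [(w, false)]) false [] pcs U =
        P.Dsample f N t τ false [] (pcs.take (τ.length * cP N) ++ w ++ pcs.drop (τ.length * cP N + N)) U ∧
      P.Esample f N (τ ++ [(w, false)]) false [] pcs U Z =
        P.Esample f N τ false [] (pcs.take (τ.length * cP N) ++ w ++ pcs.drop (τ.length * cP N + N)) U Z := by
  have hr : (τ.length + 1) * cP N ≤ pcs.length := (Nat.mul_le_mul_right _ hτ).trans hpcs
  have hpubs : P.pubs f N (τ ++ [(w, false)]) false [] pcs = P.pubs f N τ false [] (pcs.take (τ.length * cP N) ++ w ++ pcs.drop (τ.length * cP N + N)) := by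
    unfold pubs
    refine congrArg List.flatten (List.map_congr_left fun i _ => ?_)
    by_cases hi : i = τ.length
    · rw [hi, blkL_window_self (le_cP N) hw hr, posPub_fix_self τ hw]
    · rw [blkL_window_ne (le_cP N) hw hr hi, posPub_fix_ne τ _ hi]
  have hblocks : P.blocks N (τ ++ [(w, false)]) false [] pcs = P.blocks N τ false [] (pcs.take (τ.length * cP N) ++ w ++ pcs.drop (τ.length * cP N + N)) := by
    unfold blocks
    refine congrArg List.flatten (List.map_congr_left fun i _ => ?_)
    by_cases hi : i = τ.length
    · rw [hi, blkL_window_self (le_cP N) hw hr, posBlk_fix_self τ hw]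
    · rw [blkL_window_ne (le_cP N) hw hr hi, posBlk_fix_ne τ _ hi]
  unfold Dsample Esample
  rw [hpubs, hblocks]
  exact ⟨rfl, rfl⟩

/-- Beyond position `k − 1` a fixing is invisible. [folklore] -/
theorem samples_fix_ge {N t : ℕ} {τ : List (List Bool × Bool)} (hτ : P.kk N ≤ τ.length) (wc : List Bool × Bool) (pcs U Z : List Bool) :
    P.Dsample f N t (τ ++ [wc]) false [] pcs U = P.Dsample f N t τ false [] pcs U ∧
      P.Esample f N (τ ++ [wc]) false [] pcs U Z = P.Esample f N τ false [] pcs U Z := by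
  have hpubs : P.pubs f N (τ ++ [wc]) false [] pcs = P.pubs f N τ false [] pcs := by
    unfold pubs
    refine congrArg List.flatten (List.map_congr_left fun i hi => ?_)
    rw [posPub_fix_ne τ wc (by have := List.mem_range.1 hi; omega)]
  have hblocks : P.blocks N (τ ++ [wc]) false [] pcs = P.blocks N τ false [] pcs := by
    unfold blocks
    refine congrArg List.flatten (List.map_congr_left fun i hi => ?_)
    rw [posBlk_fix_ne τ wc (by have := List.mem_range.1 hi; omega)]
  unfold Dsample Esample
  rw [hpubs, hblocks]
  exact ⟨rfl, rfl⟩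

/-- **The runs**: fixing `(w, 0)` at position `|τ| < k` is overwriting the candidate slot of the coins. [folklore] -/
theorem runs_fix_eq {N t : ℕ} {τ : List (List Bool × Bool)} (hτ : τ.length < P.kk N) {w : List Bool} (hw : w.length = N)
    {r : List Bool} (hr : P.kk N * cP N ≤ r.length) :
    P.runD f A N t τ false [] (r.take (τ.length * cP N) ++ w ++ r.drop (τ.length * cP N + N)) = P.runD f A N t (τ ++ [(w, false)]) false [] r ∧
      P.runE f A N t τ false [] (r.take (τ.length * cP N) ++ w ++ r.drop (τ.length * cP N + N)) = P.runE f A N t (τ ++ [(w, false)]) false [] r := by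
  have hpN : τ.length * cP N + N ≤ P.kk N * cP N := by
    have := Nat.mul_le_mul_right (cP N) hτ; rw [Nat.succ_mul] at this; have := le_cP N; omega
  obtain ⟨h1, h2⟩ := take_window hw hpN hr
  have hpl : P.kk N * cP N ≤ (r.take (P.kk N * cP N)).length := by rw [List.length_take]; omega
  obtain ⟨hD, hE⟩ := samples_fix_eq (P := P) (f := f) (t := t) hτ hw hpl ((r.drop (P.kk N * cP N)).take (P.uLen N t))
    ((r.drop (P.kk N * cP N + P.uLen N t)).take (P.mlen N t))
  have h3 : (r.take (τ.length * cP N) ++ w ++ r.drop (τ.length * cP N + N)).drop (P.kk N * cP N + P.uLen N t) =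
      r.drop (P.kk N * cP N + P.uLen N t) := by
    rw [← List.drop_drop, h2, List.drop_drop]
  have h4 : (r.take (τ.length * cP N) ++ w ++ r.drop (τ.length * cP N + N)).drop (P.kk N * cP N + P.uLen N t + P.mlen N t) =
      r.drop (P.kk N * cP N + P.uLen N t + P.mlen N t) := by
    rw [← List.drop_drop, h3, List.drop_drop]
  unfold runD runE
  rw [h1, h2, h3, h4, ← hD, ← hE]
  exact ⟨rfl, rfl⟩

/-- Beyond position `k − 1` a fixing is invisible to the runs. [folklore] -/
theorem runs_fix_ge {N t : ℕ} {τ : List (List Bool × Bool)} (hτ : P.kk N ≤ τ.length) (wc : List Bool × Bool) (r : List Bool) :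
    P.runD f A N t (τ ++ [wc]) false [] r = P.runD f A N t τ false [] r ∧ P.runE f A N t (τ ++ [wc]) false [] r = P.runE f A N t τ false [] r := by
  unfold runD runE
  rw [(samples_fix_ge (P := P) (f := f) (t := t) hτ wc _ _ []).1, (samples_fix_ge (P := P) (f := f) (t := t) hτ wc _ _ _).2]
  exact ⟨rfl, rfl⟩

/-- **Fubini in the next free position** for `Pr[A(𝒟^{(τ)}) = 1]` and `Pr[A(ℰ^{(τ)}) = 1]`. [cite: HastadImpagliazzoLevinLuby1999, Lemma 6.3.2 (proof of (b): δ^{(j)} = pₙ E[δ₀^{(j)}(W)] + (1 − pₙ) E[δ₀^{(j)}(W̄)])] -/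
theorem acc_fubini (N t : ℕ) (τ : List (List Bool × Bool)) :
    uniformAvg N (fun w => P.accD f A N t (τ ++ [(w, false)])) = P.accD f A N t τ ∧
      uniformAvg N (fun w => P.accE f A N t (τ ++ [(w, false)])) = P.accE f A N t τ := by
  rcases lt_or_ge τ.length (P.kk N) with hτ | hτ
  · have hpN : τ.length * cP N + N ≤ P.kk N * cP N := by
      have := Nat.mul_le_mul_right (cP N) hτ; rw [Nat.succ_mul] at this; have := le_cP N; omega
    obtain ⟨cD, hcD⟩ : ∃ c, P.dTot A N t = τ.length * cP N + N + c := ⟨P.dTot A N t - (τ.length * cP N + N), by unfold dTot; omega⟩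
    obtain ⟨cEE, hcE⟩ : ∃ c, P.eTot A N t = τ.length * cP N + N + c := ⟨P.eTot A N t - (τ.length * cP N + N), by unfold eTot; omega⟩
    constructor
    · have hW := uniformAvg_window (τ.length * cP N) N cD (fun r => Greedy.ind (P.runD f A N t τ false [] r = true))
      rw [← hcD] at hW
      rw [accD, ← hW]
      refine uniformAvg_congr fun w hw => ?_
      rw [accD]
      refine uniformAvg_congr fun r hr => ?_
      rw [(runs_fix_eq hτ hw (by rw [hr]; unfold dTot; omega)).1]
    · have hW := uniformAvg_window (τ.length * cP N) N cEE (fun r => Greedy.ind (P.runE f A N t τ false [] r = true))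
      rw [← hcE] at hW
      rw [accE, ← hW]
      refine uniformAvg_congr fun w hw => ?_
      rw [accE]
      refine uniformAvg_congr fun r hr => ?_
      rw [(runs_fix_eq hτ hw (by rw [hr]; unfold eTot; omega)).2]
  · constructor
    · have h : ∀ w, P.accD f A N t (τ ++ [(w, false)]) = P.accD f A N t τ := fun w => by
        unfold accD
        simp only [(runs_fix_ge (P := P) (f := f) (A := A) (t := t) hτ (w, false) _).1]
      simp only [h, uniformAvg_const]
    · have h : ∀ w, P.accE f A N t (τ ++ [(w, false)]) = P.accE f A N t τ := fun w => by
        unfold accE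
        simp only [(runs_fix_ge (P := P) (f := f) (A := A) (t := t) hτ (w, false) _).2]
      simp only [h, uniformAvg_const]

/-- **`δ^{(τ)} = E_w[δ^{(τ·(w,0))}]`.** [cite: HastadImpagliazzoLevinLuby1999, Lemma 6.3.2 (proof of (b))] -/
theorem delta_fubini (N t : ℕ) (τ : List (List Bool × Bool)) :
    P.delta f A N t τ = uniformAvg N fun w => P.delta f A N t (τ ++ [(w, false)]) := by
  obtain ⟨hD, hE⟩ := acc_fubini (P := P) (f := f) (A := A) N t τ
  simp only [delta]
  rw [uniformAvg_sub_fun, hD, hE]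

/-! ### The laws -/

/-- **The concrete data satisfy the laws of `HILLGreedySelection`** with `pmin = 2^{−b(N)}` (`N ≥ 2`, `0 ≤ ρ ≤ 1`,
`Ns, τ ≥ 1`). [cite: HastadImpagliazzoLevinLuby1999, Lemma 6.3.2 (proof)] -/
theorem laws {N : ℕ} (hN : 2 ≤ N) (hρ0 : 0 ≤ ρf N) (hρ1 : ρf N ≤ 1) (hNs : 1 ≤ NsP.eval N) (hτn : 1 ≤ τnP.eval N) :
    (P.QD f A NsP τnP ρf N).Laws (1 / 2 ^ bLen N) := by
  have hN1 : 1 ≤ N := by omega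
  have hpow : (0 : ℝ) < 2 ^ bLen N := by positivity
  have hdens := density_law (f := f) hN1
  have ht1 := one_le_tStar f N
  have ht2 := tStar_succ_le f hN
  refine
    { abs_le := fun τ => abs_delta_le N _ τ
      fubini := fun τ => delta_fubini N _ τ
      est_good := fun τ w c _ => est_good_law (P := P) (f := f) (A := A) hNs hρ0 (tStar f N) τ (w, c)
      t_le := tStar_le f N
      density := hdens
      pmin_pos := by positivity
      pmin_le := ?_
      pmin_le' := ?_
      ρ_nonneg := hρ0
      ρ_le := hρ1
      η_nonneg := by show 0 ≤ ηf NsP ρf N; unfold ηf; positivity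
      τn_pos := hτn }
  · show 1 / (2 : ℝ) ^ bLen N ≤ ((Tt f N).card : ℝ) / 2 ^ N
    rw [← hdens]
    exact div_le_div_of_nonneg_right (by exact_mod_cast ht1) hpow.le
  · show 1 / (2 : ℝ) ^ bLen N ≤ 1 - ((Tt f N).card : ℝ) / 2 ^ N
    rw [← hdens, le_sub_iff_add_le, ← add_div, div_le_one hpow]
    have : ((1 : ℕ) : ℝ) + tStar f N ≤ ((2 ^ bLen N : ℕ) : ℝ) := by exact_mod_cast (by omega : 1 + tStar f N ≤ 2 ^ bLen N)
    push_cast at this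
    linarith

end Params

end GH

end HILL

end Literature.Computability.Cryptography
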